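import Summits.BirchSwinnertonDyer.BirchSwinnertonDyer.Theorems.KolyvaginDepthDoorMSymbolCertUniqueF
import HarnessLib

/-!
# Route `KolyvaginDepthDoor`, crux `KolyvaginDepthSupplyKN` (stmt-BirchSwinnertonDyer-22820) —
# DEPTH TABLE v27, KIT 2c/4: the random-access certificate check SPLIT INTO PARTS

Helper file of the lead prover of line `levelone` (kdd-p1 g31; `--supports stmt-BirchSwinnertonDyer-22820
--as helper`); it closes nothing and BSD is NOT proved by it.

`CertF.checkF` (kit 2b) is one Boolean; for levels `N ≳ 550` its single kernel evaluation exceeds the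
kernel's memory bound ("(kernel) excessive memory consumption detected"), although each of its conjuncts
evaluates comfortably (the kernel's reduction caches live for one declaration). This file names the four
conjunct groups `partPeel`, `partCore`, `partInv`, `partPool` and proves `checkF = true` from the four
separate facts, so that a data file can certify each part in its own `decide +kernel` declaration.
Pure Boolean bookkeeping; no mathematics.
-/

set_option linter.dupNamespace false

namespace Summit.BirchSwinnertonDyer.BirchSwinnertonDyer.Theorems.KolyvaginDepthDoor.MSymbolCert

namespace CertF

variable (C : CertF)

/-- Part 1 of `checkF`: shape conditions, unit rows of the core, and the peeling covers `{0,…,X-1}` and the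
core equations. [folklore] -/
def partPeel (gen : ℕ → Eqn) (K X : ℕ) : Bool :=
  decide (0 < C.m) && decide (1 < C.q) && decide (C.coreEqs.length = C.m - 1) &&
  decide (C.core.length = C.m) &&
  (List.range C.m).all (fun k => (List.range C.m).all fun k' =>
    C.ex (C.cr k) k' == if k = k' then 1 else 0) &&
  C.steps.all (fun s => decide (s.1 < K)) && C.coreEqs.all (fun k => decide (k < K)) &&
  (match C.peel gen C.core C.steps with
    | none => false
    | some known => (List.range X).all (fun i => decide (i ∈ known)) &&
        C.coreEqs.all (fun k => (gen k).all fun jc => decide (jc.1 ∈ known)))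

/-- Part 2 of `checkF`: the supplied core matrix `aTab` is correct. [folklore] -/
def partCore (gen : ℕ → Eqn) : Bool :=
  (List.range (C.m - 1)).all (fun r => (List.range (C.m - 1)).all fun t =>
    C.aTab r t == C.comb (gen (C.coreEqs.getD r 0)) (t + 1))

/-- Part 3 of `checkF`: `A' B ≡ 1 (mod q)`. [folklore] -/
def partInv : Bool :=
  (List.range (C.m - 1)).all (fun r => (List.range (C.m - 1)).all fun s =>
    C.abEntry r s % (C.q : ℤ) == if r = s then 1 else 0)

/-- Part 4 of `checkF`: `φ` solves the pool and is non-zero at the pivot. [folklore] -/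
def partPool (gen : ℕ → Eqn) (K : ℕ) (φ : ℕ → ℤ) : Bool :=
  (List.range K).all (fun k => evalInt φ (gen k) == 0) && (φ (C.cr 0) != 0)

/-- **`checkF` from its four parts.** [folklore] -/
theorem checkF_of_parts (gen : ℕ → Eqn) (K X : ℕ) (φ : ℕ → ℤ)
    (h1 : C.partPeel gen K X = true) (h2 : C.partCore gen = true) (h3 : C.partInv = true)
    (h4 : C.partPool gen K φ = true) : C.checkF gen K X φ = true := by
  simp only [partPeel, Bool.and_eq_true] at h1
  simp only [partPool, Bool.and_eq_true] at h4
  simp only [checkF, partCore, partInv, Bool.and_eq_true] at h2 h3 ⊢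
  exact ⟨⟨⟨⟨h1, h2⟩, h3⟩, h4.1⟩, h4.2⟩

end CertF

end Summit.BirchSwinnertonDyer.BirchSwinnertonDyer.Theorems.KolyvaginDepthDoor.MSymbolCert
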